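import Summits.Ventures.PercRepro.S2FlatTailBounds

/-!
# PercRepro — S2: THE FLAT-TAIL BOUNDS AT `15/16` — `16·(flat tail + spanning tail) ≤ 2^n`, and the `15/16` assembly lemma
(p7, gen 2; sub-claim S2, the square-multiplicity chain `P(5) = 41`)

The bounds of `S2FlatTailBounds` with the constant `16` in place of `64`, from smaller `n`: `16·(Fl(n) + Σ_{j ≤ J} C(n, j)) ≤ 2^n`
for `(J, n) = (13, ≥ 46)`, `(18, ≥ 54)`, `(23, ≥ 59)`, `(25, ≥ 64)` — the four groups of coranks `d ≤ 13 / 18 / 23 / 25` of the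
cells `(p, d)`, `p ≥ 40` (`n = p + d`) — and `level_arith16` (`level_arith` with `15/16`). Axioms: standard.
-/

namespace PercRepro

namespace S2

/-- **The tail of the cells with `d ≤ 13`**: `16·(Fl(n) + Σ_{j ≤ 13} C(n, j)) ≤ 2^n` for `n ≥ 46`. -/
theorem sixteen_mul_tail_thirteen (n : ℕ) (hn : 46 ≤ n) :
    16 * (flatTail n + ∑ j ∈ Finset.range (13 + 1), n.choose j) ≤ 2 ^ n := by
  induction n, hn using Nat.le_induction with
  | base =>
    unfold flatTail
    simp only [Finset.sum_range_succ, Finset.sum_range_zero]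
    norm_num [Nat.choose]
  | succ n hn ih =>
    have h := tail_succ_le n 13 (by omega)
    rw [pow_succ]
    omega

/-- **The tail of the cells with `d ≤ 18`**: `16·(Fl(n) + Σ_{j ≤ 18} C(n, j)) ≤ 2^n` for `n ≥ 54`. -/
theorem sixteen_mul_tail_eighteen (n : ℕ) (hn : 54 ≤ n) :
    16 * (flatTail n + ∑ j ∈ Finset.range (18 + 1), n.choose j) ≤ 2 ^ n := by
  induction n, hn using Nat.le_induction with
  | base =>
    unfold flatTail
    simp only [Finset.sum_range_succ, Finset.sum_range_zero]
    norm_num [Nat.choose]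
  | succ n hn ih =>
    have h := tail_succ_le n 18 (by omega)
    rw [pow_succ]
    omega

/-- **The tail of the cells with `d ≤ 23`**: `16·(Fl(n) + Σ_{j ≤ 23} C(n, j)) ≤ 2^n` for `n ≥ 59`. -/
theorem sixteen_mul_tail_twentythree (n : ℕ) (hn : 59 ≤ n) :
    16 * (flatTail n + ∑ j ∈ Finset.range (23 + 1), n.choose j) ≤ 2 ^ n := by
  induction n, hn using Nat.le_induction with
  | base =>
    unfold flatTail
    simp only [Finset.sum_range_succ, Finset.sum_range_zero]
    norm_num [Nat.choose]
  | succ n hn ih =>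
    have h := tail_succ_le n 23 (by omega)
    rw [pow_succ]
    omega

/-- **The tail of the cells with `d ≤ 25`**: `16·(Fl(n) + Σ_{j ≤ 25} C(n, j)) ≤ 2^n` for `n ≥ 64`. -/
theorem sixteen_mul_tail_twentyfive (n : ℕ) (hn : 64 ≤ n) :
    16 * (flatTail n + ∑ j ∈ Finset.range (25 + 1), n.choose j) ≤ 2 ^ n := by
  induction n, hn using Nat.le_induction with
  | base =>
    unfold flatTail
    simp only [Finset.sum_range_succ, Finset.sum_range_zero]
    norm_num [Nat.choose]
  | succ n hn ih =>
    have h := tail_succ_le n 25 (by omega)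
    rw [pow_succ]
    omega

/-- **The `15/16` assembly lemma** (`level_arith` with the tail `16·(A + B) ≤ 2^n`). -/
theorem level_arith16 {p d n q : ℕ} {Φ U Y A B N : ℚ} (hn : n = p + d) (hd : q ≤ d)
    (hΦ : Φ ≤ (2 : ℚ) ^ (p + q) / ((p + q).choose q : ℚ)) (hU0 : 0 ≤ U)
    (hU : U ≤ ((p + d).choose q : ℚ) + N) (hY : (2 : ℚ) ^ n ≤ Y + A + B) (hAB : 16 * (A + B) ≤ 2 ^ n)
    (hpoly : 16 * (((p + d).choose q : ℚ) + N) ≤ 15 * 2 ^ (d - q) * ((p + q).choose q : ℚ)) : Φ * U ≤ Y := by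
  have hc : (0 : ℚ) < ((p + q).choose q : ℚ) := by exact_mod_cast Nat.choose_pos (by omega)
  have hpow : (2 : ℚ) ^ n = 2 ^ (p + q) * 2 ^ (d - q) := by
    rw [← pow_add]; congr 1; omega
  have h1 : Φ * U ≤ (2 : ℚ) ^ (p + q) / ((p + q).choose q : ℚ) * U := mul_le_mul_of_nonneg_right hΦ hU0
  have h2 : (2 : ℚ) ^ (p + q) / ((p + q).choose q : ℚ) * U ≤
      (2 : ℚ) ^ (p + q) / ((p + q).choose q : ℚ) * (((p + d).choose q : ℚ) + N) :=
    mul_le_mul_of_nonneg_left hU (by positivity)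
  have h3 : (2 : ℚ) ^ (p + q) / ((p + q).choose q : ℚ) * (((p + d).choose q : ℚ) + N) ≤
      15 / 16 * 2 ^ n := by
    rw [hpow, div_mul_eq_mul_div, div_le_iff₀ hc]
    have h2p : (0 : ℚ) < 2 ^ (p + q) := by positivity
    calc (2 : ℚ) ^ (p + q) * (((p + d).choose q : ℚ) + N)
        ≤ 2 ^ (p + q) * (15 / 16 * 2 ^ (d - q) * ((p + q).choose q : ℚ)) := by
          apply mul_le_mul_of_nonneg_left _ h2p.le
          linarith
      _ = 15 / 16 * (2 ^ (p + q) * 2 ^ (d - q)) * ((p + q).choose q : ℚ) := by ring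
  have h4 : 15 / 16 * (2 : ℚ) ^ n ≤ Y := by linarith
  linarith

end S2

end PercRepro
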